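/-
Copyright: the b2b-balaban T⁴-continuum CRUX team, row NE7b OWNER lineage `t4-ne7b-p1` (gen 130). Project licence.
-/
import Summits.QuantumFields.BalabanUV.T4Continuum.Spine.NE7b.SupEffectiveActionDerivative

/-!
# THE STEP ALONG A LINE OF EXTERNAL FIELDS, I — POINTWISE CALCULUS AND THE THIRD DOMINATION: for `C³` remainders `w_x` and the line
# `ψ₀ + t·h`, with `u_x(t) = ω_x + (ψ₀,x + t h_x)`, `V_t = Σ_{x∈Y}w_x(u_x)`, `A_t = Σ w′_x(u_x)h_x`, `B_t = Σ w″_x(u_x)h_x²`, `C_t = Σ w‴_x(u_x)h_x³`: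
#   `(e^{−V_t})′ = e^{−V_t}(−A_t)`,  `(e^{−V_t}(−A_t))′ = e^{−V_t}(A_t² − B_t)`,  `(e^{−V_t}(A_t² − B_t))′ = e^{−V_t}(−A_t³ + 3A_tB_t − C_t)`,
# and on `|t − t₀| ≤ 1` the THIRD DOMINATION `e^{−V_t}(|A|³ + 3|A||B| + |C| + |A|² + |B| + |A|) ≤ e^{κ₀(1+τ⁻¹)M}·K_T·e^{½(2κ₀(1+τ)+4δ)Σ_Yω²}`
# with `M, K_T` explicit in `ψ₀, h, t₀` and the letters `κ₀, κ₁, κ₂, κ₃, τ, δ` — the integrands of `Z′, Z″, Z‴` along the line and their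
# common Gaussian dominator (row NE7b, node U5c; (297)∕(313) BY NAME; [folklore])

Cell `pub-balaban`, sub-cell `t4`, spine estimate NE7b (`T4WeightBudget.RelWeightBound`; the cell's OWN estimate — NOT PRINTED in
[Bałaban 1983–89], NOT PROVED).  Crux-route work under `Spine/NE7b/` by the row OWNER (`t4-ne7b-p1` gen 130, file (336a)) under FREEZE
(0)'s crux-prover clause, on § [NE7bP1-G130-HANDOFF] NEXT (3)(a) («D³ of the next potential along lines»); NOTHING of Bałaban's is named as
a Lean object, valued or asserted; no `T4Continuum/Support` leaf typed; no `def`, no notation; zero `sorry`.  Imports (BY NAME): the OWNER's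
(313) `…SupEffectiveActionDerivative` (through it (297) `neg_sum_le_of_stable`); Mathlib's `HasDerivAt.sum∕.comp∕.exp∕.mul`,
`Real.add_one_le_exp`, `Real.quadratic_le_exp_of_nonneg`, `Real.pow_div_factorial_le_exp`.

WHAT IS PROVED ([folklore]; `Y` a finite set of sites, `ω, ψ₀, h` fields):
* §1 `hasDerivAt_lineSite`, **`hasDerivAt_lineV`**, `hasDerivAt_lineA`, `hasDerivAt_lineB` (chain rule through `w, w′, w″`), **`hasDerivAt_lineZ0`**,
  **`hasDerivAt_lineZ1`**, **`hasDerivAt_lineZ2`** (the three integrands' `t`-derivatives);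
* §2 `sum_sq_line_le` (`Σ_Y(ψ₀+th)² ≤ M` on `|t−t₀| ≤ 1`), `abs_lineA_le`, `abs_lineB_le`, `abs_lineC_le`, `pow_le_exp_letters`
  (`S ≤ (2δ)⁻¹E`, `S² ≤ 2(2δ)⁻²E`, `S³ ≤ 6(2δ)⁻³E`, `E = e^{2δS} ≥ 1`), THE END **`third_domination`**; §3 toy.

HONEST (what this is NOT).  Pointwise calculus and one inequality; the dominated differentiations (`Z′, Z″, Z‴` along the line) are the
next file; constants explicit and unoptimised; scalar skeleton ((A3), NC-NE7b-α UNRULED); nothing of Bałaban's asserted.  BY-NAME EFFECT ON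
THE WALL: NONE.  NE7b NOT PRINTED ∕ NOT PROVED; spine PROVED 0∕9; rung (B)+1 — the programme's measures remain FINITE-torus statements; NOT
the mass gap, NOT Clay.  HONEST DEPENDENCY: continuum YM on T⁴ ⇐ BetaPertH ∧ nine spine estimates (0∕9 proved); BetaPertH ⇐ (D1) ∧ (D4) ∧
CAP+tail; G-an2-4 gates asym, D1 and NE2∕3∕4.
-/

set_option autoImplicit false

noncomputable section

namespace Summit.QuantumFields.BalabanUV.T4Continuum.NE7b.SupLinePointwise

open Finset Real
open scoped BigOperators
open SupFluctuationAPriori (neg_sum_le_of_stable)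

variable {ι : Type}

/-! ## §1. Pointwise calculus along the line -/

section Calculus

variable (Y : Finset ι) {w w' w'' w₃ : ι → ℝ → ℝ} (ω ψ₀ h : ι → ℝ)

/-- The site field along the line: `d∕dt (ω_x + (ψ₀,x + t h_x)) = h_x`. [folklore] -/
theorem hasDerivAt_lineSite (x : ι) (t : ℝ) : HasDerivAt (fun t : ℝ => ω x + (ψ₀ x + t * h x)) (h x) t := by
  have h1 := ((hasDerivAt_id t).mul_const (h x)).const_add (ψ₀ x)
  have h2 := h1.const_add (ω x)
  simpa using h2

/-- **`V_t′ = A_t`**. [folklore] -/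
theorem hasDerivAt_lineV (hw' : ∀ x t, HasDerivAt (w x) (w' x t) t) (t : ℝ) :
    HasDerivAt (fun t : ℝ => ∑ x ∈ Y, w x (ω x + (ψ₀ x + t * h x))) (∑ x ∈ Y, w' x (ω x + (ψ₀ x + t * h x)) * h x) t :=
  HasDerivAt.fun_sum fun x _ => (hw' x _).comp t (hasDerivAt_lineSite ω ψ₀ h x t)

/-- `A_t′ = B_t`. [folklore] -/
theorem hasDerivAt_lineA (hw'' : ∀ x t, HasDerivAt (w' x) (w'' x t) t) (t : ℝ) :
    HasDerivAt (fun t : ℝ => (∑ x ∈ Y, w' x (ω x + (ψ₀ x + t * h x)) * h x)) (∑ x ∈ Y, w'' x (ω x + (ψ₀ x + t * h x)) * h x ^ 2) t := by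
  have h0 : HasDerivAt (fun t : ℝ => (∑ x ∈ Y, w' x (ω x + (ψ₀ x + t * h x)) * h x))
      (∑ x ∈ Y, w'' x (ω x + (ψ₀ x + t * h x)) * h x * h x) t :=
    HasDerivAt.fun_sum fun x _ => ((hw'' x _).comp t (hasDerivAt_lineSite ω ψ₀ h x t)).mul_const (h x)
  exact h0.congr_deriv (sum_congr rfl fun x _ => by ring)

/-- `B_t′ = C_t`. [folklore] -/
theorem hasDerivAt_lineB (hw₃ : ∀ x t, HasDerivAt (w'' x) (w₃ x t) t) (t : ℝ) :
    HasDerivAt (fun t : ℝ => (∑ x ∈ Y, w'' x (ω x + (ψ₀ x + t * h x)) * h x ^ 2)) (∑ x ∈ Y, w₃ x (ω x + (ψ₀ x + t * h x)) * h x ^ 3) t := by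
  have h0 : HasDerivAt (fun t : ℝ => (∑ x ∈ Y, w'' x (ω x + (ψ₀ x + t * h x)) * h x ^ 2))
      (∑ x ∈ Y, w₃ x (ω x + (ψ₀ x + t * h x)) * h x * h x ^ 2) t :=
    HasDerivAt.fun_sum fun x _ => ((hw₃ x _).comp t (hasDerivAt_lineSite ω ψ₀ h x t)).mul_const (h x ^ 2)
  exact h0.congr_deriv (sum_congr rfl fun x _ => by ring)

/-- **`(e^{−V_t})′ = e^{−V_t}·(−A_t)`** — the integrand of `Z′` along the line. [folklore] -/
theorem hasDerivAt_lineZ0 (hw' : ∀ x t, HasDerivAt (w x) (w' x t) t) (t : ℝ) :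
    HasDerivAt (fun t : ℝ => exp (-(∑ x ∈ Y, w x (ω x + (ψ₀ x + t * h x)))))
      (exp (-(∑ x ∈ Y, w x (ω x + (ψ₀ x + t * h x)))) * -(∑ x ∈ Y, w' x (ω x + (ψ₀ x + t * h x)) * h x)) t :=
  (hasDerivAt_lineV Y ω ψ₀ h hw' t).fun_neg.exp

/-- **`(e^{−V_t}(−A_t))′ = e^{−V_t}(A_t·A_t − B_t)`** — the integrand of `Z″`. [folklore] -/
theorem hasDerivAt_lineZ1 (hw' : ∀ x t, HasDerivAt (w x) (w' x t) t) (hw'' : ∀ x t, HasDerivAt (w' x) (w'' x t) t) (t : ℝ) :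
    HasDerivAt (fun t : ℝ => exp (-(∑ x ∈ Y, w x (ω x + (ψ₀ x + t * h x)))) * -(∑ x ∈ Y, w' x (ω x + (ψ₀ x + t * h x)) * h x))
      (exp (-(∑ x ∈ Y, w x (ω x + (ψ₀ x + t * h x)))) * ((∑ x ∈ Y, w' x (ω x + (ψ₀ x + t * h x)) * h x) * (∑ x ∈ Y, w' x (ω x + (ψ₀ x + t * h x)) * h x) - (∑ x ∈ Y, w'' x (ω x + (ψ₀ x + t * h x)) * h x ^ 2))) t :=
  ((hasDerivAt_lineZ0 Y ω ψ₀ h hw' t).mul (hasDerivAt_lineA Y ω ψ₀ h hw'' t).fun_neg).congr_deriv (by ring)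

/-- **`(e^{−V_t}(A_t·A_t − B_t))′ = e^{−V_t}(−A_t·A_t·A_t + 3A_tB_t − C_t)`** — the integrand of `Z‴`. [folklore] -/
theorem hasDerivAt_lineZ2 (hw' : ∀ x t, HasDerivAt (w x) (w' x t) t) (hw'' : ∀ x t, HasDerivAt (w' x) (w'' x t) t)
    (hw₃ : ∀ x t, HasDerivAt (w'' x) (w₃ x t) t) (t : ℝ) :
    HasDerivAt (fun t : ℝ => exp (-(∑ x ∈ Y, w x (ω x + (ψ₀ x + t * h x)))) * ((∑ x ∈ Y, w' x (ω x + (ψ₀ x + t * h x)) * h x) * (∑ x ∈ Y, w' x (ω x + (ψ₀ x + t * h x)) * h x) - (∑ x ∈ Y, w'' x (ω x + (ψ₀ x + t * h x)) * h x ^ 2)))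
      (exp (-(∑ x ∈ Y, w x (ω x + (ψ₀ x + t * h x)))) * (-((∑ x ∈ Y, w' x (ω x + (ψ₀ x + t * h x)) * h x) * (∑ x ∈ Y, w' x (ω x + (ψ₀ x + t * h x)) * h x) * (∑ x ∈ Y, w' x (ω x + (ψ₀ x + t * h x)) * h x)) + 3 * ((∑ x ∈ Y, w' x (ω x + (ψ₀ x + t * h x)) * h x) * (∑ x ∈ Y, w'' x (ω x + (ψ₀ x + t * h x)) * h x ^ 2)) - (∑ x ∈ Y, w₃ x (ω x + (ψ₀ x + t * h x)) * h x ^ 3))) t :=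
  ((hasDerivAt_lineZ0 Y ω ψ₀ h hw' t).fun_mul (((hasDerivAt_lineA Y ω ψ₀ h hw'' t).fun_mul (hasDerivAt_lineA Y ω ψ₀ h hw'' t)).fun_sub
    (hasDerivAt_lineB Y ω ψ₀ h hw₃ t))).congr_deriv (by ring)

end Calculus

/-! ## §2. The third domination on `|t − t₀| ≤ 1` -/

section Domination

variable (Y : Finset ι) {w w' w'' w₃ : ι → ℝ → ℝ} {κ₀ κ₁ κ₂ κ₃ τ δ : ℝ} (ω ψ₀ h : ι → ℝ)

/-- On `|t − t₀| ≤ 1`: `Σ_Y(ψ₀,x + t h_x)² ≤ M = Σ_Y(|ψ₀,x| + (|t₀|+1)|h_x|)²`. [folklore] -/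
theorem sum_sq_line_le {t₀ t : ℝ} (ht : |t - t₀| ≤ 1) : ∑ x ∈ Y, (ψ₀ x + t * h x) ^ 2 ≤ (∑ x ∈ Y, (|ψ₀ x| + (|t₀| + 1) * |h x|) ^ 2) := by
  have ht' : |t| ≤ |t₀| + 1 := by
    have := abs_sub_abs_le_abs_sub t t₀
    linarith
  refine sum_le_sum fun x _ => ?_
  have hle : |ψ₀ x + t * h x| ≤ |ψ₀ x| + (|t₀| + 1) * |h x| := by
    refine (abs_add_le _ _).trans ?_
    rw [abs_mul]
    nlinarith [abs_nonneg (h x), abs_nonneg t]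
  calc (ψ₀ x + t * h x) ^ 2 = |ψ₀ x + t * h x| ^ 2 := (sq_abs _).symm
    _ ≤ (|ψ₀ x| + (|t₀| + 1) * |h x|) ^ 2 := pow_le_pow_left₀ (abs_nonneg _) hle 2

/-- `|A_t| ≤ κ₁(Σ_Yω² + M + ½Σ_Yh²)` (`|w′_x(u)| ≤ κ₁|u|`, `|u||h| ≤ ½(u² + h²)`, `u² ≤ 2ω² + 2(ψ₀+th)²`). [folklore] -/
theorem abs_lineA_le (hκ₁ : 0 ≤ κ₁) (hw'b : ∀ x u, |w' x u| ≤ κ₁ * |u|) {t₀ t : ℝ} (ht : |t - t₀| ≤ 1) :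
    |(∑ x ∈ Y, w' x (ω x + (ψ₀ x + t * h x)) * h x)| ≤ κ₁ * ((∑ x ∈ Y, ω x ^ 2) + ((∑ x ∈ Y, (|ψ₀ x| + (|t₀| + 1) * |h x|) ^ 2) + (∑ x ∈ Y, h x ^ 2) / 2)) := by
  have hM := sum_sq_line_le Y ψ₀ h ht
  have hpt : ∀ x ∈ Y, |w' x (ω x + (ψ₀ x + t * h x)) * h x| ≤ κ₁ * (ω x ^ 2 + (ψ₀ x + t * h x) ^ 2 + h x ^ 2 / 2) := fun x _ => by
    rw [abs_mul]
    have h1 := hw'b x (ω x + (ψ₀ x + t * h x))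
    have h2 : |(ω x + (ψ₀ x + t * h x))| * |h x| ≤ (ω x ^ 2 + (ψ₀ x + t * h x) ^ 2 + h x ^ 2 / 2) := by
      have e1 : (ω x + (ψ₀ x + t * h x)) ^ 2 ≤ 2 * ω x ^ 2 + 2 * (ψ₀ x + t * h x) ^ 2 := by nlinarith [sq_nonneg (ω x - (ψ₀ x + t * h x))]
      nlinarith [sq_nonneg (|(ω x + (ψ₀ x + t * h x))| - |h x|), sq_abs (ω x + (ψ₀ x + t * h x)), sq_abs (h x), abs_nonneg (ω x + (ψ₀ x + t * h x)), abs_nonneg (h x)]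
    calc |w' x (ω x + (ψ₀ x + t * h x))| * |h x| ≤ κ₁ * |(ω x + (ψ₀ x + t * h x))| * |h x| := mul_le_mul_of_nonneg_right h1 (abs_nonneg _)
      _ = κ₁ * (|(ω x + (ψ₀ x + t * h x))| * |h x|) := by ring
      _ ≤ κ₁ * (ω x ^ 2 + (ψ₀ x + t * h x) ^ 2 + h x ^ 2 / 2) := mul_le_mul_of_nonneg_left h2 hκ₁
  refine (abs_sum_le_sum_abs _ _).trans ((sum_le_sum hpt).trans ?_)
  rw [← mul_sum, sum_add_distrib, sum_add_distrib, ← sum_div]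
  exact mul_le_mul_of_nonneg_left (by linarith) hκ₁

/-- `|B_t| ≤ κ₂Σ_Yh²`. [folklore] -/
theorem abs_lineB_le (hw''b : ∀ x u, |w'' x u| ≤ κ₂) (t : ℝ) : |(∑ x ∈ Y, w'' x (ω x + (ψ₀ x + t * h x)) * h x ^ 2)| ≤ κ₂ * (∑ x ∈ Y, h x ^ 2) := by
  refine (abs_sum_le_sum_abs _ _).trans ?_
  rw [mul_sum]
  refine sum_le_sum fun x _ => ?_
  rw [abs_mul, abs_of_nonneg (sq_nonneg (h x))]
  exact mul_le_mul_of_nonneg_right (hw''b x _) (sq_nonneg _)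

/-- `|C_t| ≤ κ₃Σ_Y|h|³`. [folklore] -/
theorem abs_lineC_le (hw₃b : ∀ x u, |w₃ x u| ≤ κ₃) (t : ℝ) : |(∑ x ∈ Y, w₃ x (ω x + (ψ₀ x + t * h x)) * h x ^ 3)| ≤ κ₃ * (∑ x ∈ Y, |h x| ^ 3) := by
  refine (abs_sum_le_sum_abs _ _).trans ?_
  rw [mul_sum]
  refine sum_le_sum fun x _ => ?_
  rw [abs_mul, abs_pow]
  exact mul_le_mul_of_nonneg_right (hw₃b x _) (pow_nonneg (abs_nonneg _) 3)

omit ι in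
/-- The polynomial letters under one exponential: `S ≥ 0`, `δ > 0`, `E = e^{2δS}` ⟹ `1 ≤ E`, `S ≤ (2δ)⁻¹E`, `S² ≤ 2((2δ)²)⁻¹E`,
`S³ ≤ 6((2δ)³)⁻¹E`. [folklore] -/
theorem pow_le_exp_letters {S δ : ℝ} (hS : 0 ≤ S) (hδ : 0 < δ) :
    1 ≤ exp (2 * δ * S) ∧ S ≤ (2 * δ)⁻¹ * exp (2 * δ * S) ∧ S ^ 2 ≤ 2 * ((2 * δ) ^ 2)⁻¹ * exp (2 * δ * S) ∧
      S ^ 3 ≤ 6 * ((2 * δ) ^ 3)⁻¹ * exp (2 * δ * S) := by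
  have h2δ : 0 < 2 * δ := by positivity
  have hx : 0 ≤ 2 * δ * S := by positivity
  refine ⟨one_le_exp hx, ?_, ?_, ?_⟩
  · have h1 := add_one_le_exp (2 * δ * S)
    rw [le_inv_mul_iff₀ h2δ]
    linarith
  · have h1 := quadratic_le_exp_of_nonneg hx
    rw [mul_comm (2 : ℝ) ((2 * δ) ^ 2)⁻¹, mul_assoc, le_inv_mul_iff₀ (by positivity)]
    nlinarith
  · have h1 := pow_div_factorial_le_exp (2 * δ * S) hx 3
    rw [show Nat.factorial 3 = 6 from rfl] at h1
    push_cast at h1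
    rw [div_le_iff₀ (by norm_num : (0 : ℝ) < 6)] at h1
    rw [mul_comm (6 : ℝ) ((2 * δ) ^ 3)⁻¹, mul_assoc, le_inv_mul_iff₀ (by positivity)]
    nlinarith

/-- **THE THIRD DOMINATION**: stability (`κ₀ ≥ 0`), `|w′_x(u)| ≤ κ₁|u|` (`κ₁ ≥ 0`), `|w″| ≤ κ₂`, `|w‴| ≤ κ₃`, `0 < τ`, `0 < δ` ⟹ for `|t − t₀| ≤ 1` and
every `ω`: `e^{−V_t}·(|A|³ + 3|A||B| + |C| + |A|² + |B| + |A|) ≤ e^{κ₀(1+τ⁻¹)M}·K_T·e^{½(2κ₀(1+τ)+4δ)Σ_Yω²}`, `M = Σ_Y(|ψ₀|+(|t₀|+1)|h|)²`,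
`M₁ = M + ½Σh²`, `K_T = 4κ₁³(6(2δ)⁻³ + M₁³) + 3κ₁κ₂Σh²((2δ)⁻¹ + M₁) + κ₃Σ|h|³ + 2κ₁²(2(2δ)⁻² + M₁²) + κ₂Σh² + κ₁((2δ)⁻¹ + M₁)`. [folklore] -/
theorem third_domination (hκ₀ : 0 ≤ κ₀) (hκ₁ : 0 ≤ κ₁) (hτ : 0 < τ) (hδ : 0 < δ) (hstab : ∀ x, ∀ u : ℝ, -(κ₀ * u ^ 2) ≤ w x u)
    (hw'b : ∀ x u, |w' x u| ≤ κ₁ * |u|) (hκ₂ : 0 ≤ κ₂) (hw''b : ∀ x u, |w'' x u| ≤ κ₂) (hκ₃ : 0 ≤ κ₃) (hw₃b : ∀ x u, |w₃ x u| ≤ κ₃)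
    {t₀ t : ℝ} (ht : |t - t₀| ≤ 1) :
    exp (-(∑ x ∈ Y, w x (ω x + (ψ₀ x + t * h x)))) *
        (|(∑ x ∈ Y, w' x (ω x + (ψ₀ x + t * h x)) * h x)| * |(∑ x ∈ Y, w' x (ω x + (ψ₀ x + t * h x)) * h x)| * |(∑ x ∈ Y, w' x (ω x + (ψ₀ x + t * h x)) * h x)| + 3 * (|(∑ x ∈ Y, w' x (ω x + (ψ₀ x + t * h x)) * h x)| * |(∑ x ∈ Y, w'' x (ω x + (ψ₀ x + t * h x)) * h x ^ 2)|) + |(∑ x ∈ Y, w₃ x (ω x + (ψ₀ x + t * h x)) * h x ^ 3)| +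
        |(∑ x ∈ Y, w' x (ω x + (ψ₀ x + t * h x)) * h x)| * |(∑ x ∈ Y, w' x (ω x + (ψ₀ x + t * h x)) * h x)| + |(∑ x ∈ Y, w'' x (ω x + (ψ₀ x + t * h x)) * h x ^ 2)| + |(∑ x ∈ Y, w' x (ω x + (ψ₀ x + t * h x)) * h x)|) ≤
      exp (κ₀ * (1 + τ⁻¹) * (∑ x ∈ Y, (|ψ₀ x| + (|t₀| + 1) * |h x|) ^ 2)) *
        (4 * κ₁ ^ 3 * (6 * ((2 * δ) ^ 3)⁻¹ + ((∑ x ∈ Y, (|ψ₀ x| + (|t₀| + 1) * |h x|) ^ 2) + (∑ x ∈ Y, h x ^ 2) / 2) ^ 3) + 3 * κ₁ * κ₂ * (∑ x ∈ Y, h x ^ 2) * ((2 * δ)⁻¹ + ((∑ x ∈ Y, (|ψ₀ x| + (|t₀| + 1) * |h x|) ^ 2) + (∑ x ∈ Y, h x ^ 2) / 2)) + κ₃ * (∑ x ∈ Y, |h x| ^ 3) +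
          2 * κ₁ ^ 2 * (2 * ((2 * δ) ^ 2)⁻¹ + ((∑ x ∈ Y, (|ψ₀ x| + (|t₀| + 1) * |h x|) ^ 2) + (∑ x ∈ Y, h x ^ 2) / 2) ^ 2) + κ₂ * (∑ x ∈ Y, h x ^ 2) + κ₁ * ((2 * δ)⁻¹ + ((∑ x ∈ Y, (|ψ₀ x| + (|t₀| + 1) * |h x|) ^ 2) + (∑ x ∈ Y, h x ^ 2) / 2))) *
        exp ((2 * κ₀ * (1 + τ) + 4 * δ) * (∑ x ∈ Y, ω x ^ 2) / 2) := by
  have hS0 : 0 ≤ (∑ x ∈ Y, ω x ^ 2) := sum_nonneg fun x _ => sq_nonneg _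
  have hM₁0 : 0 ≤ ((∑ x ∈ Y, (|ψ₀ x| + (|t₀| + 1) * |h x|) ^ 2) + (∑ x ∈ Y, h x ^ 2) / 2) := by positivity
  have hP0 : 0 ≤ (∑ x ∈ Y, ω x ^ 2) + ((∑ x ∈ Y, (|ψ₀ x| + (|t₀| + 1) * |h x|) ^ 2) + (∑ x ∈ Y, h x ^ 2) / 2) := add_nonneg hS0 hM₁0
  have ha0 : 0 ≤ |(∑ x ∈ Y, w' x (ω x + (ψ₀ x + t * h x)) * h x)| := abs_nonneg _
  have hb0 : 0 ≤ |(∑ x ∈ Y, w'' x (ω x + (ψ₀ x + t * h x)) * h x ^ 2)| := abs_nonneg _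
  -- the letters
  have hA := abs_lineA_le Y ω ψ₀ h hκ₁ hw'b ht
  have hB := abs_lineB_le Y ω ψ₀ h hw''b t
  have hC := abs_lineC_le Y ω ψ₀ h hw₃b t
  have hV := neg_sum_le_of_stable Y w hκ₀ hτ hstab (fun x => ω x) (fun x => ψ₀ x + t * h x)
  have hψM := sum_sq_line_le Y ψ₀ h ht
  obtain ⟨hE1, hS1, hS2, hS3⟩ := pow_le_exp_letters hS0 hδ
  -- step 1: products of the letters
  have haa : |(∑ x ∈ Y, w' x (ω x + (ψ₀ x + t * h x)) * h x)| * |(∑ x ∈ Y, w' x (ω x + (ψ₀ x + t * h x)) * h x)| ≤ (κ₁ * ((∑ x ∈ Y, ω x ^ 2) + ((∑ x ∈ Y, (|ψ₀ x| + (|t₀| + 1) * |h x|) ^ 2) + (∑ x ∈ Y, h x ^ 2) / 2))) * (κ₁ * ((∑ x ∈ Y, ω x ^ 2) + ((∑ x ∈ Y, (|ψ₀ x| + (|t₀| + 1) * |h x|) ^ 2) + (∑ x ∈ Y, h x ^ 2) / 2))) :=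
    mul_le_mul hA hA ha0 (by positivity)
  have haaa : |(∑ x ∈ Y, w' x (ω x + (ψ₀ x + t * h x)) * h x)| * |(∑ x ∈ Y, w' x (ω x + (ψ₀ x + t * h x)) * h x)| * |(∑ x ∈ Y, w' x (ω x + (ψ₀ x + t * h x)) * h x)| ≤
      (κ₁ * ((∑ x ∈ Y, ω x ^ 2) + ((∑ x ∈ Y, (|ψ₀ x| + (|t₀| + 1) * |h x|) ^ 2) + (∑ x ∈ Y, h x ^ 2) / 2))) * (κ₁ * ((∑ x ∈ Y, ω x ^ 2) + ((∑ x ∈ Y, (|ψ₀ x| + (|t₀| + 1) * |h x|) ^ 2) + (∑ x ∈ Y, h x ^ 2) / 2))) * (κ₁ * ((∑ x ∈ Y, ω x ^ 2) + ((∑ x ∈ Y, (|ψ₀ x| + (|t₀| + 1) * |h x|) ^ 2) + (∑ x ∈ Y, h x ^ 2) / 2))) := mul_le_mul haa hA ha0 (by positivity)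
  have hab : |(∑ x ∈ Y, w' x (ω x + (ψ₀ x + t * h x)) * h x)| * |(∑ x ∈ Y, w'' x (ω x + (ψ₀ x + t * h x)) * h x ^ 2)| ≤ (κ₁ * ((∑ x ∈ Y, ω x ^ 2) + ((∑ x ∈ Y, (|ψ₀ x| + (|t₀| + 1) * |h x|) ^ 2) + (∑ x ∈ Y, h x ^ 2) / 2))) * (κ₂ * (∑ x ∈ Y, h x ^ 2)) :=
    mul_le_mul hA hB hb0 (by positivity)
  -- step 2: powers of `S + M₁` under the exponential `E = e^{2δS}`
  have hcube : ((∑ x ∈ Y, ω x ^ 2) + ((∑ x ∈ Y, (|ψ₀ x| + (|t₀| + 1) * |h x|) ^ 2) + (∑ x ∈ Y, h x ^ 2) / 2)) ^ 3 ≤ 4 * ((∑ x ∈ Y, ω x ^ 2) ^ 3 + ((∑ x ∈ Y, (|ψ₀ x| + (|t₀| + 1) * |h x|) ^ 2) + (∑ x ∈ Y, h x ^ 2) / 2) ^ 3) := by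
    have e : 4 * ((∑ x ∈ Y, ω x ^ 2) ^ 3 + ((∑ x ∈ Y, (|ψ₀ x| + (|t₀| + 1) * |h x|) ^ 2) + (∑ x ∈ Y, h x ^ 2) / 2) ^ 3) - ((∑ x ∈ Y, ω x ^ 2) + ((∑ x ∈ Y, (|ψ₀ x| + (|t₀| + 1) * |h x|) ^ 2) + (∑ x ∈ Y, h x ^ 2) / 2)) ^ 3 =
        3 * (((∑ x ∈ Y, ω x ^ 2) + ((∑ x ∈ Y, (|ψ₀ x| + (|t₀| + 1) * |h x|) ^ 2) + (∑ x ∈ Y, h x ^ 2) / 2)) * ((∑ x ∈ Y, ω x ^ 2) - ((∑ x ∈ Y, (|ψ₀ x| + (|t₀| + 1) * |h x|) ^ 2) + (∑ x ∈ Y, h x ^ 2) / 2)) ^ 2) := by ring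
    have h0 : 0 ≤ ((∑ x ∈ Y, ω x ^ 2) + ((∑ x ∈ Y, (|ψ₀ x| + (|t₀| + 1) * |h x|) ^ 2) + (∑ x ∈ Y, h x ^ 2) / 2)) * ((∑ x ∈ Y, ω x ^ 2) - ((∑ x ∈ Y, (|ψ₀ x| + (|t₀| + 1) * |h x|) ^ 2) + (∑ x ∈ Y, h x ^ 2) / 2)) ^ 2 := mul_nonneg hP0 (sq_nonneg _)
    linarith only [e, h0]
  have hsq : ((∑ x ∈ Y, ω x ^ 2) + ((∑ x ∈ Y, (|ψ₀ x| + (|t₀| + 1) * |h x|) ^ 2) + (∑ x ∈ Y, h x ^ 2) / 2)) ^ 2 ≤ 2 * ((∑ x ∈ Y, ω x ^ 2) ^ 2 + ((∑ x ∈ Y, (|ψ₀ x| + (|t₀| + 1) * |h x|) ^ 2) + (∑ x ∈ Y, h x ^ 2) / 2) ^ 2) := by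
    have e : 2 * ((∑ x ∈ Y, ω x ^ 2) ^ 2 + ((∑ x ∈ Y, (|ψ₀ x| + (|t₀| + 1) * |h x|) ^ 2) + (∑ x ∈ Y, h x ^ 2) / 2) ^ 2) - ((∑ x ∈ Y, ω x ^ 2) + ((∑ x ∈ Y, (|ψ₀ x| + (|t₀| + 1) * |h x|) ^ 2) + (∑ x ∈ Y, h x ^ 2) / 2)) ^ 2 = ((∑ x ∈ Y, ω x ^ 2) - ((∑ x ∈ Y, (|ψ₀ x| + (|t₀| + 1) * |h x|) ^ 2) + (∑ x ∈ Y, h x ^ 2) / 2)) ^ 2 := by ring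
    linarith only [e, sq_nonneg ((∑ x ∈ Y, ω x ^ 2) - ((∑ x ∈ Y, (|ψ₀ x| + (|t₀| + 1) * |h x|) ^ 2) + (∑ x ∈ Y, h x ^ 2) / 2))]
  have hM₁E1 : ((∑ x ∈ Y, (|ψ₀ x| + (|t₀| + 1) * |h x|) ^ 2) + (∑ x ∈ Y, h x ^ 2) / 2) ≤ ((∑ x ∈ Y, (|ψ₀ x| + (|t₀| + 1) * |h x|) ^ 2) + (∑ x ∈ Y, h x ^ 2) / 2) * exp (2 * δ * (∑ x ∈ Y, ω x ^ 2)) := le_mul_of_one_le_right hM₁0 hE1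
  have hM₁E2 : ((∑ x ∈ Y, (|ψ₀ x| + (|t₀| + 1) * |h x|) ^ 2) + (∑ x ∈ Y, h x ^ 2) / 2) ^ 2 ≤ ((∑ x ∈ Y, (|ψ₀ x| + (|t₀| + 1) * |h x|) ^ 2) + (∑ x ∈ Y, h x ^ 2) / 2) ^ 2 * exp (2 * δ * (∑ x ∈ Y, ω x ^ 2)) := le_mul_of_one_le_right (by positivity) hE1
  have hM₁E3 : ((∑ x ∈ Y, (|ψ₀ x| + (|t₀| + 1) * |h x|) ^ 2) + (∑ x ∈ Y, h x ^ 2) / 2) ^ 3 ≤ ((∑ x ∈ Y, (|ψ₀ x| + (|t₀| + 1) * |h x|) ^ 2) + (∑ x ∈ Y, h x ^ 2) / 2) ^ 3 * exp (2 * δ * (∑ x ∈ Y, ω x ^ 2)) := le_mul_of_one_le_right (by positivity) hE1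
  have hsum3 : (∑ x ∈ Y, ω x ^ 2) ^ 3 + ((∑ x ∈ Y, (|ψ₀ x| + (|t₀| + 1) * |h x|) ^ 2) + (∑ x ∈ Y, h x ^ 2) / 2) ^ 3 ≤ (6 * ((2 * δ) ^ 3)⁻¹ + ((∑ x ∈ Y, (|ψ₀ x| + (|t₀| + 1) * |h x|) ^ 2) + (∑ x ∈ Y, h x ^ 2) / 2) ^ 3) * exp (2 * δ * (∑ x ∈ Y, ω x ^ 2)) := by
    have e : (6 * ((2 * δ) ^ 3)⁻¹ + ((∑ x ∈ Y, (|ψ₀ x| + (|t₀| + 1) * |h x|) ^ 2) + (∑ x ∈ Y, h x ^ 2) / 2) ^ 3) * exp (2 * δ * (∑ x ∈ Y, ω x ^ 2)) =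
        6 * ((2 * δ) ^ 3)⁻¹ * exp (2 * δ * (∑ x ∈ Y, ω x ^ 2)) + ((∑ x ∈ Y, (|ψ₀ x| + (|t₀| + 1) * |h x|) ^ 2) + (∑ x ∈ Y, h x ^ 2) / 2) ^ 3 * exp (2 * δ * (∑ x ∈ Y, ω x ^ 2)) := by ring
    linarith only [e, hS3, hM₁E3]
  have hsum2 : (∑ x ∈ Y, ω x ^ 2) ^ 2 + ((∑ x ∈ Y, (|ψ₀ x| + (|t₀| + 1) * |h x|) ^ 2) + (∑ x ∈ Y, h x ^ 2) / 2) ^ 2 ≤ (2 * ((2 * δ) ^ 2)⁻¹ + ((∑ x ∈ Y, (|ψ₀ x| + (|t₀| + 1) * |h x|) ^ 2) + (∑ x ∈ Y, h x ^ 2) / 2) ^ 2) * exp (2 * δ * (∑ x ∈ Y, ω x ^ 2)) := by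
    have e : (2 * ((2 * δ) ^ 2)⁻¹ + ((∑ x ∈ Y, (|ψ₀ x| + (|t₀| + 1) * |h x|) ^ 2) + (∑ x ∈ Y, h x ^ 2) / 2) ^ 2) * exp (2 * δ * (∑ x ∈ Y, ω x ^ 2)) =
        2 * ((2 * δ) ^ 2)⁻¹ * exp (2 * δ * (∑ x ∈ Y, ω x ^ 2)) + ((∑ x ∈ Y, (|ψ₀ x| + (|t₀| + 1) * |h x|) ^ 2) + (∑ x ∈ Y, h x ^ 2) / 2) ^ 2 * exp (2 * δ * (∑ x ∈ Y, ω x ^ 2)) := by ring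
    linarith only [e, hS2, hM₁E2]
  have hsum1 : (∑ x ∈ Y, ω x ^ 2) + ((∑ x ∈ Y, (|ψ₀ x| + (|t₀| + 1) * |h x|) ^ 2) + (∑ x ∈ Y, h x ^ 2) / 2) ≤ ((2 * δ)⁻¹ + ((∑ x ∈ Y, (|ψ₀ x| + (|t₀| + 1) * |h x|) ^ 2) + (∑ x ∈ Y, h x ^ 2) / 2)) * exp (2 * δ * (∑ x ∈ Y, ω x ^ 2)) := by
    have e : ((2 * δ)⁻¹ + ((∑ x ∈ Y, (|ψ₀ x| + (|t₀| + 1) * |h x|) ^ 2) + (∑ x ∈ Y, h x ^ 2) / 2)) * exp (2 * δ * (∑ x ∈ Y, ω x ^ 2)) = (2 * δ)⁻¹ * exp (2 * δ * (∑ x ∈ Y, ω x ^ 2)) + ((∑ x ∈ Y, (|ψ₀ x| + (|t₀| + 1) * |h x|) ^ 2) + (∑ x ∈ Y, h x ^ 2) / 2) * exp (2 * δ * (∑ x ∈ Y, ω x ^ 2)) := by ring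
    linarith only [e, hS1, hM₁E1]
  have h3a : |(∑ x ∈ Y, w' x (ω x + (ψ₀ x + t * h x)) * h x)| * |(∑ x ∈ Y, w' x (ω x + (ψ₀ x + t * h x)) * h x)| * |(∑ x ∈ Y, w' x (ω x + (ψ₀ x + t * h x)) * h x)| ≤
      4 * κ₁ ^ 3 * (6 * ((2 * δ) ^ 3)⁻¹ + ((∑ x ∈ Y, (|ψ₀ x| + (|t₀| + 1) * |h x|) ^ 2) + (∑ x ∈ Y, h x ^ 2) / 2) ^ 3) * exp (2 * δ * (∑ x ∈ Y, ω x ^ 2)) :=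
    calc _ ≤ (κ₁ * ((∑ x ∈ Y, ω x ^ 2) + ((∑ x ∈ Y, (|ψ₀ x| + (|t₀| + 1) * |h x|) ^ 2) + (∑ x ∈ Y, h x ^ 2) / 2))) * (κ₁ * ((∑ x ∈ Y, ω x ^ 2) + ((∑ x ∈ Y, (|ψ₀ x| + (|t₀| + 1) * |h x|) ^ 2) + (∑ x ∈ Y, h x ^ 2) / 2))) * (κ₁ * ((∑ x ∈ Y, ω x ^ 2) + ((∑ x ∈ Y, (|ψ₀ x| + (|t₀| + 1) * |h x|) ^ 2) + (∑ x ∈ Y, h x ^ 2) / 2))) := haaa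
      _ = κ₁ ^ 3 * ((∑ x ∈ Y, ω x ^ 2) + ((∑ x ∈ Y, (|ψ₀ x| + (|t₀| + 1) * |h x|) ^ 2) + (∑ x ∈ Y, h x ^ 2) / 2)) ^ 3 := by ring
      _ ≤ κ₁ ^ 3 * (4 * ((∑ x ∈ Y, ω x ^ 2) ^ 3 + ((∑ x ∈ Y, (|ψ₀ x| + (|t₀| + 1) * |h x|) ^ 2) + (∑ x ∈ Y, h x ^ 2) / 2) ^ 3)) := mul_le_mul_of_nonneg_left hcube (by positivity)
      _ ≤ κ₁ ^ 3 * (4 * ((6 * ((2 * δ) ^ 3)⁻¹ + ((∑ x ∈ Y, (|ψ₀ x| + (|t₀| + 1) * |h x|) ^ 2) + (∑ x ∈ Y, h x ^ 2) / 2) ^ 3) * exp (2 * δ * (∑ x ∈ Y, ω x ^ 2)))) :=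
          mul_le_mul_of_nonneg_left (mul_le_mul_of_nonneg_left hsum3 (by norm_num)) (by positivity)
      _ = _ := by ring
  have h2a : |(∑ x ∈ Y, w' x (ω x + (ψ₀ x + t * h x)) * h x)| * |(∑ x ∈ Y, w' x (ω x + (ψ₀ x + t * h x)) * h x)| ≤ 2 * κ₁ ^ 2 * (2 * ((2 * δ) ^ 2)⁻¹ + ((∑ x ∈ Y, (|ψ₀ x| + (|t₀| + 1) * |h x|) ^ 2) + (∑ x ∈ Y, h x ^ 2) / 2) ^ 2) * exp (2 * δ * (∑ x ∈ Y, ω x ^ 2)) :=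
    calc _ ≤ (κ₁ * ((∑ x ∈ Y, ω x ^ 2) + ((∑ x ∈ Y, (|ψ₀ x| + (|t₀| + 1) * |h x|) ^ 2) + (∑ x ∈ Y, h x ^ 2) / 2))) * (κ₁ * ((∑ x ∈ Y, ω x ^ 2) + ((∑ x ∈ Y, (|ψ₀ x| + (|t₀| + 1) * |h x|) ^ 2) + (∑ x ∈ Y, h x ^ 2) / 2))) := haa
      _ = κ₁ ^ 2 * ((∑ x ∈ Y, ω x ^ 2) + ((∑ x ∈ Y, (|ψ₀ x| + (|t₀| + 1) * |h x|) ^ 2) + (∑ x ∈ Y, h x ^ 2) / 2)) ^ 2 := by ring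
      _ ≤ κ₁ ^ 2 * (2 * ((∑ x ∈ Y, ω x ^ 2) ^ 2 + ((∑ x ∈ Y, (|ψ₀ x| + (|t₀| + 1) * |h x|) ^ 2) + (∑ x ∈ Y, h x ^ 2) / 2) ^ 2)) := mul_le_mul_of_nonneg_left hsq (by positivity)
      _ ≤ κ₁ ^ 2 * (2 * ((2 * ((2 * δ) ^ 2)⁻¹ + ((∑ x ∈ Y, (|ψ₀ x| + (|t₀| + 1) * |h x|) ^ 2) + (∑ x ∈ Y, h x ^ 2) / 2) ^ 2) * exp (2 * δ * (∑ x ∈ Y, ω x ^ 2)))) :=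
          mul_le_mul_of_nonneg_left (mul_le_mul_of_nonneg_left hsum2 (by norm_num)) (by positivity)
      _ = _ := by ring
  have h1a : |(∑ x ∈ Y, w' x (ω x + (ψ₀ x + t * h x)) * h x)| ≤ κ₁ * ((2 * δ)⁻¹ + ((∑ x ∈ Y, (|ψ₀ x| + (|t₀| + 1) * |h x|) ^ 2) + (∑ x ∈ Y, h x ^ 2) / 2)) * exp (2 * δ * (∑ x ∈ Y, ω x ^ 2)) :=
    calc _ ≤ κ₁ * ((∑ x ∈ Y, ω x ^ 2) + ((∑ x ∈ Y, (|ψ₀ x| + (|t₀| + 1) * |h x|) ^ 2) + (∑ x ∈ Y, h x ^ 2) / 2)) := hA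
      _ ≤ κ₁ * (((2 * δ)⁻¹ + ((∑ x ∈ Y, (|ψ₀ x| + (|t₀| + 1) * |h x|) ^ 2) + (∑ x ∈ Y, h x ^ 2) / 2)) * exp (2 * δ * (∑ x ∈ Y, ω x ^ 2))) := mul_le_mul_of_nonneg_left hsum1 hκ₁
      _ = _ := by ring
  have h1b : |(∑ x ∈ Y, w'' x (ω x + (ψ₀ x + t * h x)) * h x ^ 2)| ≤ κ₂ * (∑ x ∈ Y, h x ^ 2) * exp (2 * δ * (∑ x ∈ Y, ω x ^ 2)) := hB.trans (le_mul_of_one_le_right (by positivity) hE1)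
  have h1c : |(∑ x ∈ Y, w₃ x (ω x + (ψ₀ x + t * h x)) * h x ^ 3)| ≤ κ₃ * (∑ x ∈ Y, |h x| ^ 3) * exp (2 * δ * (∑ x ∈ Y, ω x ^ 2)) := hC.trans (le_mul_of_one_le_right (by positivity) hE1)
  have hab' : |(∑ x ∈ Y, w' x (ω x + (ψ₀ x + t * h x)) * h x)| * |(∑ x ∈ Y, w'' x (ω x + (ψ₀ x + t * h x)) * h x ^ 2)| ≤ κ₁ * κ₂ * (∑ x ∈ Y, h x ^ 2) * ((2 * δ)⁻¹ + ((∑ x ∈ Y, (|ψ₀ x| + (|t₀| + 1) * |h x|) ^ 2) + (∑ x ∈ Y, h x ^ 2) / 2)) * exp (2 * δ * (∑ x ∈ Y, ω x ^ 2)) :=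
    calc _ ≤ (κ₁ * ((∑ x ∈ Y, ω x ^ 2) + ((∑ x ∈ Y, (|ψ₀ x| + (|t₀| + 1) * |h x|) ^ 2) + (∑ x ∈ Y, h x ^ 2) / 2))) * (κ₂ * (∑ x ∈ Y, h x ^ 2)) := hab
      _ ≤ (κ₁ * (((2 * δ)⁻¹ + ((∑ x ∈ Y, (|ψ₀ x| + (|t₀| + 1) * |h x|) ^ 2) + (∑ x ∈ Y, h x ^ 2) / 2)) * exp (2 * δ * (∑ x ∈ Y, ω x ^ 2)))) * (κ₂ * (∑ x ∈ Y, h x ^ 2)) :=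
          mul_le_mul_of_nonneg_right (mul_le_mul_of_nonneg_left hsum1 hκ₁) (by positivity)
      _ = _ := by ring
  have eK : (4 * κ₁ ^ 3 * (6 * ((2 * δ) ^ 3)⁻¹ + ((∑ x ∈ Y, (|ψ₀ x| + (|t₀| + 1) * |h x|) ^ 2) + (∑ x ∈ Y, h x ^ 2) / 2) ^ 3) + 3 * κ₁ * κ₂ * (∑ x ∈ Y, h x ^ 2) * ((2 * δ)⁻¹ + ((∑ x ∈ Y, (|ψ₀ x| + (|t₀| + 1) * |h x|) ^ 2) + (∑ x ∈ Y, h x ^ 2) / 2)) + κ₃ * (∑ x ∈ Y, |h x| ^ 3) +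
          2 * κ₁ ^ 2 * (2 * ((2 * δ) ^ 2)⁻¹ + ((∑ x ∈ Y, (|ψ₀ x| + (|t₀| + 1) * |h x|) ^ 2) + (∑ x ∈ Y, h x ^ 2) / 2) ^ 2) + κ₂ * (∑ x ∈ Y, h x ^ 2) + κ₁ * ((2 * δ)⁻¹ + ((∑ x ∈ Y, (|ψ₀ x| + (|t₀| + 1) * |h x|) ^ 2) + (∑ x ∈ Y, h x ^ 2) / 2))) * exp (2 * δ * (∑ x ∈ Y, ω x ^ 2)) =
      4 * κ₁ ^ 3 * (6 * ((2 * δ) ^ 3)⁻¹ + ((∑ x ∈ Y, (|ψ₀ x| + (|t₀| + 1) * |h x|) ^ 2) + (∑ x ∈ Y, h x ^ 2) / 2) ^ 3) * exp (2 * δ * (∑ x ∈ Y, ω x ^ 2)) +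
        3 * (κ₁ * κ₂ * (∑ x ∈ Y, h x ^ 2) * ((2 * δ)⁻¹ + ((∑ x ∈ Y, (|ψ₀ x| + (|t₀| + 1) * |h x|) ^ 2) + (∑ x ∈ Y, h x ^ 2) / 2)) * exp (2 * δ * (∑ x ∈ Y, ω x ^ 2))) + κ₃ * (∑ x ∈ Y, |h x| ^ 3) * exp (2 * δ * (∑ x ∈ Y, ω x ^ 2)) +
        2 * κ₁ ^ 2 * (2 * ((2 * δ) ^ 2)⁻¹ + ((∑ x ∈ Y, (|ψ₀ x| + (|t₀| + 1) * |h x|) ^ 2) + (∑ x ∈ Y, h x ^ 2) / 2) ^ 2) * exp (2 * δ * (∑ x ∈ Y, ω x ^ 2)) + κ₂ * (∑ x ∈ Y, h x ^ 2) * exp (2 * δ * (∑ x ∈ Y, ω x ^ 2)) +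
        κ₁ * ((2 * δ)⁻¹ + ((∑ x ∈ Y, (|ψ₀ x| + (|t₀| + 1) * |h x|) ^ 2) + (∑ x ∈ Y, h x ^ 2) / 2)) * exp (2 * δ * (∑ x ∈ Y, ω x ^ 2)) := by ring
  have hT : (|(∑ x ∈ Y, w' x (ω x + (ψ₀ x + t * h x)) * h x)| * |(∑ x ∈ Y, w' x (ω x + (ψ₀ x + t * h x)) * h x)| * |(∑ x ∈ Y, w' x (ω x + (ψ₀ x + t * h x)) * h x)| + 3 * (|(∑ x ∈ Y, w' x (ω x + (ψ₀ x + t * h x)) * h x)| * |(∑ x ∈ Y, w'' x (ω x + (ψ₀ x + t * h x)) * h x ^ 2)|) + |(∑ x ∈ Y, w₃ x (ω x + (ψ₀ x + t * h x)) * h x ^ 3)| +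
        |(∑ x ∈ Y, w' x (ω x + (ψ₀ x + t * h x)) * h x)| * |(∑ x ∈ Y, w' x (ω x + (ψ₀ x + t * h x)) * h x)| + |(∑ x ∈ Y, w'' x (ω x + (ψ₀ x + t * h x)) * h x ^ 2)| + |(∑ x ∈ Y, w' x (ω x + (ψ₀ x + t * h x)) * h x)|) ≤ (4 * κ₁ ^ 3 * (6 * ((2 * δ) ^ 3)⁻¹ + ((∑ x ∈ Y, (|ψ₀ x| + (|t₀| + 1) * |h x|) ^ 2) + (∑ x ∈ Y, h x ^ 2) / 2) ^ 3) + 3 * κ₁ * κ₂ * (∑ x ∈ Y, h x ^ 2) * ((2 * δ)⁻¹ + ((∑ x ∈ Y, (|ψ₀ x| + (|t₀| + 1) * |h x|) ^ 2) + (∑ x ∈ Y, h x ^ 2) / 2)) + κ₃ * (∑ x ∈ Y, |h x| ^ 3) +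
          2 * κ₁ ^ 2 * (2 * ((2 * δ) ^ 2)⁻¹ + ((∑ x ∈ Y, (|ψ₀ x| + (|t₀| + 1) * |h x|) ^ 2) + (∑ x ∈ Y, h x ^ 2) / 2) ^ 2) + κ₂ * (∑ x ∈ Y, h x ^ 2) + κ₁ * ((2 * δ)⁻¹ + ((∑ x ∈ Y, (|ψ₀ x| + (|t₀| + 1) * |h x|) ^ 2) + (∑ x ∈ Y, h x ^ 2) / 2))) * exp (2 * δ * (∑ x ∈ Y, ω x ^ 2)) := by
    rw [eK]
    linarith only [h3a, hab', h1c, h2a, h1b, h1a]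
  -- step 3: the exponent
  have hV' : -(∑ x ∈ Y, w x (ω x + (ψ₀ x + t * h x))) ≤ κ₀ * (1 + τ) * (∑ x ∈ Y, ω x ^ 2) + κ₀ * (1 + τ⁻¹) * (∑ x ∈ Y, (|ψ₀ x| + (|t₀| + 1) * |h x|) ^ 2) := by
    have h2 : κ₀ * (1 + τ⁻¹) * ∑ x ∈ Y, (ψ₀ x + t * h x) ^ 2 ≤ κ₀ * (1 + τ⁻¹) * (∑ x ∈ Y, (|ψ₀ x| + (|t₀| + 1) * |h x|) ^ 2) :=
      mul_le_mul_of_nonneg_left hψM (by positivity)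
    linarith only [hV, h2]
  -- step 4: assemble
  have hT0 : 0 ≤ (|(∑ x ∈ Y, w' x (ω x + (ψ₀ x + t * h x)) * h x)| * |(∑ x ∈ Y, w' x (ω x + (ψ₀ x + t * h x)) * h x)| * |(∑ x ∈ Y, w' x (ω x + (ψ₀ x + t * h x)) * h x)| + 3 * (|(∑ x ∈ Y, w' x (ω x + (ψ₀ x + t * h x)) * h x)| * |(∑ x ∈ Y, w'' x (ω x + (ψ₀ x + t * h x)) * h x ^ 2)|) + |(∑ x ∈ Y, w₃ x (ω x + (ψ₀ x + t * h x)) * h x ^ 3)| +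
        |(∑ x ∈ Y, w' x (ω x + (ψ₀ x + t * h x)) * h x)| * |(∑ x ∈ Y, w' x (ω x + (ψ₀ x + t * h x)) * h x)| + |(∑ x ∈ Y, w'' x (ω x + (ψ₀ x + t * h x)) * h x ^ 2)| + |(∑ x ∈ Y, w' x (ω x + (ψ₀ x + t * h x)) * h x)|) := by positivity
  have he : exp (κ₀ * (1 + τ) * (∑ x ∈ Y, ω x ^ 2) + κ₀ * (1 + τ⁻¹) * (∑ x ∈ Y, (|ψ₀ x| + (|t₀| + 1) * |h x|) ^ 2)) * exp (2 * δ * (∑ x ∈ Y, ω x ^ 2)) =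
      exp (κ₀ * (1 + τ⁻¹) * (∑ x ∈ Y, (|ψ₀ x| + (|t₀| + 1) * |h x|) ^ 2)) * exp ((2 * κ₀ * (1 + τ) + 4 * δ) * (∑ x ∈ Y, ω x ^ 2) / 2) := by
    rw [← exp_add, ← exp_add]
    congr 1
    ring
  calc exp (-(∑ x ∈ Y, w x (ω x + (ψ₀ x + t * h x)))) * (|(∑ x ∈ Y, w' x (ω x + (ψ₀ x + t * h x)) * h x)| * |(∑ x ∈ Y, w' x (ω x + (ψ₀ x + t * h x)) * h x)| * |(∑ x ∈ Y, w' x (ω x + (ψ₀ x + t * h x)) * h x)| + 3 * (|(∑ x ∈ Y, w' x (ω x + (ψ₀ x + t * h x)) * h x)| * |(∑ x ∈ Y, w'' x (ω x + (ψ₀ x + t * h x)) * h x ^ 2)|) + |(∑ x ∈ Y, w₃ x (ω x + (ψ₀ x + t * h x)) * h x ^ 3)| +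
        |(∑ x ∈ Y, w' x (ω x + (ψ₀ x + t * h x)) * h x)| * |(∑ x ∈ Y, w' x (ω x + (ψ₀ x + t * h x)) * h x)| + |(∑ x ∈ Y, w'' x (ω x + (ψ₀ x + t * h x)) * h x ^ 2)| + |(∑ x ∈ Y, w' x (ω x + (ψ₀ x + t * h x)) * h x)|)
      ≤ exp (κ₀ * (1 + τ) * (∑ x ∈ Y, ω x ^ 2) + κ₀ * (1 + τ⁻¹) * (∑ x ∈ Y, (|ψ₀ x| + (|t₀| + 1) * |h x|) ^ 2)) * ((4 * κ₁ ^ 3 * (6 * ((2 * δ) ^ 3)⁻¹ + ((∑ x ∈ Y, (|ψ₀ x| + (|t₀| + 1) * |h x|) ^ 2) + (∑ x ∈ Y, h x ^ 2) / 2) ^ 3) + 3 * κ₁ * κ₂ * (∑ x ∈ Y, h x ^ 2) * ((2 * δ)⁻¹ + ((∑ x ∈ Y, (|ψ₀ x| + (|t₀| + 1) * |h x|) ^ 2) + (∑ x ∈ Y, h x ^ 2) / 2)) + κ₃ * (∑ x ∈ Y, |h x| ^ 3) +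
          2 * κ₁ ^ 2 * (2 * ((2 * δ) ^ 2)⁻¹ + ((∑ x ∈ Y, (|ψ₀ x| + (|t₀| + 1) * |h x|) ^ 2) + (∑ x ∈ Y, h x ^ 2) / 2) ^ 2) + κ₂ * (∑ x ∈ Y, h x ^ 2) + κ₁ * ((2 * δ)⁻¹ + ((∑ x ∈ Y, (|ψ₀ x| + (|t₀| + 1) * |h x|) ^ 2) + (∑ x ∈ Y, h x ^ 2) / 2))) * exp (2 * δ * (∑ x ∈ Y, ω x ^ 2))) :=
        mul_le_mul (exp_le_exp.2 hV') hT hT0 (exp_pos _).le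
    _ = (4 * κ₁ ^ 3 * (6 * ((2 * δ) ^ 3)⁻¹ + ((∑ x ∈ Y, (|ψ₀ x| + (|t₀| + 1) * |h x|) ^ 2) + (∑ x ∈ Y, h x ^ 2) / 2) ^ 3) + 3 * κ₁ * κ₂ * (∑ x ∈ Y, h x ^ 2) * ((2 * δ)⁻¹ + ((∑ x ∈ Y, (|ψ₀ x| + (|t₀| + 1) * |h x|) ^ 2) + (∑ x ∈ Y, h x ^ 2) / 2)) + κ₃ * (∑ x ∈ Y, |h x| ^ 3) +
          2 * κ₁ ^ 2 * (2 * ((2 * δ) ^ 2)⁻¹ + ((∑ x ∈ Y, (|ψ₀ x| + (|t₀| + 1) * |h x|) ^ 2) + (∑ x ∈ Y, h x ^ 2) / 2) ^ 2) + κ₂ * (∑ x ∈ Y, h x ^ 2) + κ₁ * ((2 * δ)⁻¹ + ((∑ x ∈ Y, (|ψ₀ x| + (|t₀| + 1) * |h x|) ^ 2) + (∑ x ∈ Y, h x ^ 2) / 2))) * (exp (κ₀ * (1 + τ) * (∑ x ∈ Y, ω x ^ 2) + κ₀ * (1 + τ⁻¹) * (∑ x ∈ Y, (|ψ₀ x|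 + (|t₀| + 1) * |h x|) ^ 2)) * exp (2 * δ * (∑ x ∈ Y, ω x ^ 2))) := by ring
    _ = _ := by rw [he]; ring

end Domination

/-! ## §3. Toy -/

/-- Toy (§1): on one site with `ω = ψ₀ = 0` and `h = 1` the site field along the line is `t ↦ 0 + (0 + t·1)` with derivative `1`. -/
example (t : ℝ) : HasDerivAt (fun t : ℝ => (fun _ : Unit => (0 : ℝ)) () + ((fun _ : Unit => (0 : ℝ)) () + t * (fun _ : Unit => (1 : ℝ)) ()))
    ((fun _ : Unit => (1 : ℝ)) ()) t :=
  hasDerivAt_lineSite (fun _ : Unit => (0 : ℝ)) (fun _ => 0) (fun _ => 1) () t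

end Summit.QuantumFields.BalabanUV.T4Continuum.NE7b.SupLinePointwise
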